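import Mathlib.Topology.Algebra.ClopenNhdofOne
import Literature.NumberTheory.Automorphic.CompactGroupKFiniteVectors
import HarnessLib

/-!
# Finite-dimensional invariant subspaces for compact and profinite groups (the `K'_v`-finite
# vectors of Gelbart's proof, quaternion side)
(Bröcker–tom Dieck, *Representations of compact Lie groups* (1985), III (5.6)–(5.7); Gelbart,
*Automorphic forms on adele groups* (1975), §10, p. 151: "we fix a `K'_v`-finite unit vector
`u'_v` in the space of `π'_v`")

Topic `NumberTheory/Automorphic`; theorems only (no definition, no named fact, no instance).
Companion of `CompactGroupKFiniteVectors` (existence of non-zero `G`-finite smears for compact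
groups whose `G`-finite functions separate points) and of `HilbertRepFiniteTypeIdempotent` (the
idempotent datum of the trace comparison from a finite-dimensional invariant subspace), closing
the quaternion-side input of `multiplicity_one_quaternionUnits_of_testFamily`
(`QuaternionUnitsMultiplicityOneOfTestFamily`) for compact totally disconnected groups such as
`𝒪_{D_S}^× = ∏_{v ∈ S} 𝒪_{D_v}^×`:

* `exists_finiteDimensional_invariant_of_compactSpace` — for a strongly continuous representation
  of a compact group whose `G`-finite continuous functions separate points, every non-zero closed
  invariant subspace contains a non-zero finite-dimensional invariant subspace (the span of the
  orbit of a non-zero `G`-finite smear).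
* `separatesPoints_translationFiniteSubalgebra_of_totallyDisconnectedSpace` — on a compact totally
  disconnected (`T₁`) group the `G`-finite continuous functions separate points: indicators of
  cosets of open normal subgroups (`ProfiniteGrp.exist_openNormalSubgroup_sub_open_nhds_of_one`)
  are continuous, `G`-finite (finitely many cosets) and separate.

## References

* T. Bröcker, T. tom Dieck, *Representations of compact Lie groups*, GTM 98 (1985), III
  (5.6)–(5.7) [BrockerTomDieck1985].
* S. Gelbart, *Automorphic forms on adele groups*, Ann. of Math. Studies 83 (1975), §10, p. 151
  [Gelbart1975].
-/

noncomputable section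

open MeasureTheory
open scoped InnerProductSpace Pointwise

namespace Literature.NumberTheory.Automorphic

section Compact

variable {G : Type*} [TopologicalSpace G] [Group G] [IsTopologicalGroup G] [MeasurableSpace G]
  [BorelSpace G] [CompactSpace G]
  {H : Type*} [NormedAddCommGroup H] [InnerProductSpace ℂ H] [CompleteSpace H]

/-- **Every non-zero closed invariant subspace of a strongly continuous representation of a
compact group contains a non-zero finite-dimensional invariant subspace**, provided the
`G`-finite continuous functions separate points (Peter–Weyl; Bröcker–tom Dieck (1985), III
(5.6)–(5.7)): for `0 ≠ v ∈ S` a `G`-finite smear `π(ψ) v ≠ 0` lies in `S`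
(`exists_isTranslationFinite_smear_ne_zero`, `smear_mem_of_isClosed`) and its orbit spans a
finite-dimensional invariant subspace of `S`. [cite: BrockerTomDieck1985, III (5.6)–(5.7)] -/
theorem exists_finiteDimensional_invariant_of_compactSpace (π : ContRepresentation ℂ G H)
    (hπ : π.IsStronglyContinuous) (μ : Measure G) [IsFiniteMeasureOnCompacts μ]
    [μ.IsOpenPosMeasure] [μ.IsMulLeftInvariant]
    (hsep : (translationFiniteSubalgebra G).SeparatesPoints)
    (S : Submodule ℂ H) (hS : IsClosed (S : Set H)) (hinv : ∀ (g : G), ∀ w ∈ S, π g w ∈ S)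
    (hS0 : S ≠ ⊥) :
    ∃ V : Submodule ℂ H, FiniteDimensional ℂ V ∧ V ≤ S ∧ V ≠ ⊥ ∧ ∀ (g : G), ∀ v ∈ V, π g v ∈ V := by
  obtain ⟨v, hvS, hv0⟩ := (Submodule.ne_bot_iff S).1 hS0
  obtain ⟨ψ, -, hne, hfd⟩ := exists_isTranslationFinite_smear_ne_zero (μ := μ) hπ hsep hv0
  set w : H := smear π μ ψ v with hw
  have hwS : w ∈ S := smear_mem_of_isClosed hπ hS hinv ψ hvS
  refine ⟨Submodule.span ℂ (Set.range fun g : G => π g w), hfd, ?_, ?_, ?_⟩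
  · rw [Submodule.span_le]
    rintro _ ⟨g, rfl⟩
    exact hinv g w hwS
  · intro h0
    apply hne
    have h1 : π 1 w ∈ Submodule.span ℂ (Set.range fun g : G => π g w) :=
      Submodule.subset_span ⟨1, rfl⟩
    rw [h0, Submodule.mem_bot, map_one] at h1
    exact h1
  · intro g u hu
    induction hu using Submodule.span_induction with
    | mem x hx =>
      obtain ⟨g', rfl⟩ := hx
      refine Submodule.subset_span ⟨g * g', ?_⟩
      change π (g * g') w = π g (π g' w)
      rw [map_mul]
      rfl
    | zero => rw [map_zero]; exact Submodule.zero_mem _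
    | add x y _ _ hx hy => rw [map_add]; exact Submodule.add_mem _ hx hy
    | smul a x _ hx => rw [map_smul]; exact Submodule.smul_mem _ a hx

end Compact

section Profinite

variable {G : Type*} [TopologicalSpace G] [Group G] [IsTopologicalGroup G] [CompactSpace G]
  [TotallyDisconnectedSpace G] [T1Space G]

/-- **On a profinite group the `G`-finite continuous functions separate points**: for `x ≠ y`
there is an open normal subgroup `N` with `x⁻¹ y ∉ N`
(`ProfiniteGrp.exist_openNormalSubgroup_sub_open_nhds_of_one`); the indicator of the coset `x N`
is continuous (it factors through the finite discrete quotient `G ⧸ N`), separates `x` from `y`,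
and its left translates are indicators of cosets, finitely many. So
`exists_finiteDimensional_invariant_of_compactSpace` applies to compact totally disconnected
groups, e.g. the unit groups `𝒪_{D_v}^×` of local division algebras and their finite products.
[folklore] -/
theorem separatesPoints_translationFiniteSubalgebra_of_totallyDisconnectedSpace :
    (translationFiniteSubalgebra G).SeparatesPoints := by
  classical
  intro x y hxy
  -- an open normal subgroup missing `x⁻¹ y`
  have hU : IsOpen ({x⁻¹ * y}ᶜ : Set G) := isOpen_compl_singleton
  have h1U : (1 : G) ∈ ({x⁻¹ * y}ᶜ : Set G) := by
    rw [Set.mem_compl_singleton_iff]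
    intro h
    apply hxy
    calc x = x * 1 := (mul_one x).symm
      _ = x * (x⁻¹ * y) := by rw [← h]
      _ = y := mul_inv_cancel_left x y
  obtain ⟨N, hN⟩ := ProfiniteGrp.exist_openNormalSubgroup_sub_open_nhds_of_one hU h1U
  have hxyN : x⁻¹ * y ∉ (N : Set G) := fun h => by
    have := hN h
    rw [Set.mem_compl_singleton_iff] at this
    exact this rfl
  -- indicators of cosets of `N`, continuous through the finite discrete quotient
  let χ : G ⧸ N.toOpenSubgroup.toSubgroup → C(G, ℂ) := fun q =>
    ⟨fun h => if (QuotientGroup.mk h : G ⧸ N.toOpenSubgroup.toSubgroup) = q then 1 else 0,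
      (continuous_of_discreteTopology (f := fun q' : G ⧸ N.toOpenSubgroup.toSubgroup =>
        if q' = q then (1 : ℂ) else 0)).comp QuotientGroup.continuous_mk⟩
  have hχ_apply : ∀ q h, χ q h =
      if (QuotientGroup.mk h : G ⧸ N.toOpenSubgroup.toSubgroup) = q then 1 else 0 := fun q h => rfl
  -- left translates of `χ q` are `χ (g • q)`
  have htrans : ∀ (g : G) (q : G ⧸ N.toOpenSubgroup.toSubgroup),
      leftTranslate g (χ q) = χ (g • q) := by
    intro g q
    ext h
    rw [leftTranslate_apply, hχ_apply, hχ_apply]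
    have hiff : (QuotientGroup.mk (g⁻¹ * h) : G ⧸ N.toOpenSubgroup.toSubgroup) = q ↔
        (QuotientGroup.mk h : G ⧸ N.toOpenSubgroup.toSubgroup) = g • q := by
      constructor
      · intro hq
        rw [← hq, MulAction.Quotient.smul_mk, smul_eq_mul, mul_inv_cancel_left]
      · intro hq
        rw [← smul_eq_mul, ← MulAction.Quotient.smul_mk, hq, inv_smul_smul]
    by_cases hc : (QuotientGroup.mk h : G ⧸ N.toOpenSubgroup.toSubgroup) = g • q
    · rw [if_pos (hiff.2 hc), if_pos hc]
    · rw [if_neg (mt hiff.1 hc), if_neg hc]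
  -- the `χ q` span a finite-dimensional translation-stable space
  set F : Submodule ℂ C(G, ℂ) := Submodule.span ℂ (Set.range χ) with hF
  haveI : FiniteDimensional ℂ F := FiniteDimensional.span_of_finite ℂ (Set.finite_range χ)
  have hmemA : ∀ q, χ q ∈ translationFiniteSubalgebra G := fun q =>
    mem_translationFiniteSubalgebra.2 ⟨F, inferInstance, fun g => by
      rw [htrans]
      exact Submodule.subset_span ⟨_, rfl⟩⟩
  -- `χ (x N)` separates `x` from `y`
  have hsep : χ (QuotientGroup.mk x) x ≠ χ (QuotientGroup.mk x) y := by
    rw [hχ_apply, hχ_apply, if_pos rfl, if_neg]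
    · exact one_ne_zero
    · intro h
      rw [QuotientGroup.eq] at h
      apply hxyN
      have h' := N.toOpenSubgroup.toSubgroup.inv_mem h
      rwa [mul_inv_rev, inv_inv] at h'
  exact ⟨χ (QuotientGroup.mk x), ⟨χ (QuotientGroup.mk x), hmemA _, rfl⟩, hsep⟩

end Profinite

end Literature.NumberTheory.Automorphic
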